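import Literature.Geometry.Lorentzian.KerrKillingAlgebra
import Literature.Geometry.Lorentzian.KerrKillingTangency
import Literature.Geometry.Lorentzian.KerrIngoingCoordKretschmann
import Literature.Geometry.Lorentzian.KerrIngoingCoordCubicInvariant
import HarnessLib

/-!
# KerrKillingAlgebra — proofs

Discharge of the named fact `Literature.Geometry.Lorentzian.ONeill1995_kerrKillingFields`
(`KerrKillingAlgebra.lean`; O'Neill, *The Geometry of Kerr Black Holes* (1995), §3.7, Cor. 3.7.4:
every Killing field of a Kerr spacetime is a constant combination of `∂̃_t`, `∂̃_φ`).

| fact | status here |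
|---|---|
| `ONeill1995_kerrKillingFields` | **PROVED**: `ONeill1995_kerrKillingFields_holds` (= `ONeill1995_kerrKillingFields_of_cubicClosedForm` applied to the cubic closed form `Kerr.cubicTrace_kerrBilin_closedForm`, transported from `Kerr.Ingoing.cubicTrace_basisFun` of `KerrIngoingCoordCubicInvariant.lean`) |

The argument (flow-free form of O'Neill's proof of Cor. 3.7.4 via Prop. 3.7.1 and the isometric
invariants `r`, `C²` of Ch. 5) is assembled in `KerrKillingTangency.lean`
(`Kerr.killingField_eq_combination`) from `KillingCoordInvariants.lean` (Killing fields annihilate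
`|Rm|²` and the cubic trace invariant) and `KerrKillingOrbit.lean` (orbit-tangent Killing fields
are constant combinations). Of its two closed-form inputs, the Kretschmann scalar
`|Rm|² = 48 M² Re (r + ia cos θ)⁶/Σ⁶` is supplied here from the tree's ingoing-coordinate
computation `Kerr.Ingoing.rmNormSqAt_bilin` (`KerrIngoingCoordKretschmann.lean`) and the transport
`Kerr.rmNormSqAt_kerrBilin_of_ingoing` (`KerrCurvatureInvariantsTransport.lean`); the cubic one
`𝒞 = 48 M³ Re (r + ia cos θ)⁹/Σ⁹` is supplied the same way from the tree's ingoing-coordinate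
computation `Kerr.Ingoing.cubicTrace_basisFun` (`KerrIngoingCoordCubicInvariant.lean`, principal
frame) and the transport `Kerr.cubicTrace_kerrBilin_of_ingoing` — first kept as the hypothesis `hC`
of `ONeill1995_kerrKillingFields_of_cubicClosedForm`, then discharged in
`ONeill1995_kerrKillingFields_holds`.

## References

* B. O'Neill, *The Geometry of Kerr Black Holes*, A K Peters (1995), §3.7, Prop. 3.7.1,
  Cor. 3.7.4; Ch. 5. [ONeill1995]
* M. Visser, *The Kerr spacetime: a brief introduction*, arXiv:0706.0622, §3, §5. [arXiv07060622]
-/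

noncomputable section

open scoped Manifold ContDiff Topology
open Set Filter Function
open Literature.Geometry.Lorentzian.MetricCoord

namespace Literature.Geometry.Lorentzian

namespace Kerr

/-- **The Kretschmann scalar of Kerr in the Kerr–Schild chart**, `|Rm|² = 48 M² Re (r + ia cos θ)⁶/Σ⁶`
at every point with `r > 0`, from the ingoing-coordinate closed form `Kerr.Ingoing.rmNormSqAt_bilin`
by transport and density (`Kerr.rmNormSqAt_kerrBilin_of_ingoing`). (The statement is the body of
the named fact `Kerr.kretschmannScalar_closedForm` at `M, a, x`; it is kept a local helper here,
the fact itself being discharged in `KerrCurvatureInvariants.lean`.) [cite: arXiv07060622, §3] -/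
private theorem rmNormSqAt_kerrBilin_closedForm (M a : ℝ) (x : E4) (hx : 0 < radius a x) :
    rmNormSqAt (Kerr.bilin M a) x =
      48 * M ^ 2 * (((radius a x : ℂ) + ((a * (x 3 / radius a x) : ℝ) : ℂ) * Complex.I) ^ 6).re /
        (radius a x ^ 2 + (a * (x 3 / radius a x)) ^ 2) ^ 6 := by
  refine rmNormSqAt_kerrBilin_of_ingoing M a (fun u hu ↦ ?_) x hx
  rw [Ingoing.rmNormSqAt_bilin M a (Ingoing.mem_regularSet_of_mem_coordDomain hu)]
  simp only [Ingoing.sigma]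
  ring

end Kerr

/-- **O'Neill's Corollary 3.7.4 (`ONeill1995_kerrKillingFields`) from the cubic closed form.**
Every Killing field of the `C^∞` Kerr metric on the exterior block of a rotating subextremal Kerr
spacetime (ingoing Kerr–Schild Cartesian chart) is a constant combination `α ∂_{t*} + β ∂_{φ*}` —
proved from the closed form `hC` of the cubic trace invariant of the Kerr curvature
(`48 M³ Re (r + ia cos θ)⁹/Σ⁹`, all real `M, a`, every point with `r > 0`, every basis; verbatim
stub F4 of `stmt-FinalStateConjecture-10047`), everything else being in the tree:
`Kerr.killingField_eq_combination` (`KerrKillingTangency.lean`) with the Kretschmann closed form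
`Kerr.rmNormSqAt_kerrBilin_closedForm`. [cite: ONeill1995, §3.7, Cor. 3.7.4] -/
theorem ONeill1995_kerrKillingFields_of_cubicClosedForm
    (hC : ∀ (M a : ℝ) (x : E4), 0 < Kerr.radius a x → ∀ b : Module.Basis (Fin 4) ℝ E4,
      ∑ i, ∑ i', ∑ j, ∑ j', ∑ k, ∑ k',
        ginv (Kerr.bilin M a) b x i i' * ginv (Kerr.bilin M a) b x j j' *
        ginv (Kerr.bilin M a) b x k k' *
        traceCLM E4 ((riemAt (Kerr.bilin M a) x (b i) (b j)).comp
          ((riemAt (Kerr.bilin M a) x (b j') (b k)).comp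
            (riemAt (Kerr.bilin M a) x (b k') (b i')))) =
      48 * M ^ 3 * (((Kerr.radius a x : ℂ) +
        ((a * (x 3 / Kerr.radius a x) : ℝ) : ℂ) * Complex.I) ^ 9).re /
        (Kerr.radius a x ^ 2 + (a * (x 3 / Kerr.radius a x)) ^ 2) ^ 9) :
    ONeill1995_kerrKillingFields := by
  intro _ M a _ ha hsub X hX
  exact Kerr.killingField_eq_combination M a ha hsub (Kerr.rmNormSqAt_kerrBilin_closedForm M a)
    (hC M a) X hX

namespace Kerr

/-- **The cubic trace invariant of Kerr in the Kerr–Schild chart**,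
`Σ g g g tr(R∘R∘R) = 48 M³ Re (r + ia cos θ)⁹/Σ⁹` at every point with `r > 0` and in every basis, from
the ingoing-coordinate closed form `Kerr.Ingoing.cubicTrace_basisFun` by transport and density
(`Kerr.cubicTrace_kerrBilin_of_ingoing`). (The statement is that of stub F4 of
`stmt-FinalStateConjecture-10047`, proved in `Summits/…/PhotonSphereChannelsTameCensorshipKerrCubicWeyl.lean`,
which Literature cannot import; kept a local helper here.) [cite: KerrSchild1965, §3] -/
private theorem cubicTrace_kerrBilin_closedForm (M a : ℝ) (x : E4) (hx : 0 < radius a x)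
    (b : Module.Basis (Fin 4) ℝ E4) :
    ∑ i, ∑ i', ∑ j, ∑ j', ∑ k, ∑ k',
        ginv (Kerr.bilin M a) b x i i' * ginv (Kerr.bilin M a) b x j j' *
        ginv (Kerr.bilin M a) b x k k' *
        traceCLM E4 ((riemAt (Kerr.bilin M a) x (b i) (b j)).comp
          ((riemAt (Kerr.bilin M a) x (b j') (b k)).comp
            (riemAt (Kerr.bilin M a) x (b k') (b i')))) =
      48 * M ^ 3 * (((radius a x : ℂ) + ((a * (x 3 / radius a x) : ℝ) : ℂ) * Complex.I) ^ 9).re /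
        (radius a x ^ 2 + (a * (x 3 / radius a x)) ^ 2) ^ 9 :=
  cubicTrace_kerrBilin_of_ingoing M a
    (fun _ hu ↦ Ingoing.cubicTrace_basisFun M a (Ingoing.mem_regularSet_of_mem_coordDomain hu)) x hx b

end Kerr

/-- **O'Neill 1995, Corollary 3.7.4, for the rotating subextremal Kerr exterior — discharge of the
named fact `ONeill1995_kerrKillingFields`.** Every Killing vector field of the `C^∞` Kerr metric on
the exterior block `{r > r₊}` of a Kerr spacetime with `0 < |a| < M` (ingoing Kerr–Schild Cartesian
chart, `Kerr.smoothMetric M a r₊`) is a constant linear combination `α ∂_{t*} + β ∂_{φ*}` of the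
stationary and axial Killing fields. Proof (flow-free form of O'Neill's argument via Prop. 3.7.1 and
the isometric invariants `r`, `C²` of Ch. 5): a Killing field annihilates the Kretschmann scalar and
the cubic trace invariant (`KillingCoordInvariants.lean`), whose closed forms
`48 M² Re(r + ia cos θ)⁶/Σ⁶` (`Kerr.Ingoing.rmNormSqAt_bilin` + transport) and
`48 M³ Re(r + ia cos θ)⁹/Σ⁹` (`Kerr.Ingoing.cubicTrace_basisFun` + transport) have independent
differentials off the equatorial hyperplane, so the field is tangent to the `(t*, φ*)`-orbits
(`KerrKillingTangency.lean`); orbit-tangent Killing fields are constant combinations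
(`KerrKillingOrbit.lean`), and the axis follows by density.
[cite: ONeill1995, §3.7, Cor. 3.7.4 (with Prop. 3.7.1, Def. 2.3.1)] -/
theorem ONeill1995_kerrKillingFields_holds : ONeill1995_kerrKillingFields :=
  ONeill1995_kerrKillingFields_of_cubicClosedForm Kerr.cubicTrace_kerrBilin_closedForm

end Literature.Geometry.Lorentzian

end
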